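import Mathlib
import HarnessLib
import Literature.Probability.Percolation.MinOpenCut
import Literature.Probability.Percolation.MinOpenCutMenger
import Summits.CriticalPhenomena.PercolationContinuityZ3.Theses.PercBudgetLadder
import Summits.CriticalPhenomena.PercolationContinuityZ3.Theorems.PercBudgetLadderBudgetTightnessStubMarkov
import Summits.CriticalPhenomena.PercolationContinuityZ3.Theorems.PercBudgetLadderBudgetTightnessStubSixLids
import Summits.CriticalPhenomena.PercolationContinuityZ3.Theorems.PercBudgetLadderBudgetTightnessStubBkTail
import Summits.CriticalPhenomena.PercolationContinuityZ3.Theorems.PercBudgetLadderBudgetTightnessStubPatchCutset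
import Summits.CriticalPhenomena.PercolationContinuityZ3.Theorems.PercBudgetLadderBudgetTightnessStubThickMono
import Summits.CriticalPhenomena.PercolationContinuityZ3.Theorems.PercBudgetLadderBudgetTightnessStubSuperadditive
import Summits.CriticalPhenomena.PercolationContinuityZ3.Theorems.PercBudgetLadderBudgetTightnessStubCritCrossing
import Summits.CriticalPhenomena.PercolationContinuityZ3.Theorems.PercBudgetLadderBudgetTightnessCoreDensity
import Summits.CriticalPhenomena.PercolationContinuityZ3.Theorems.PercBudgetLadderBudgetTightnessStubFloor
import Summits.CriticalPhenomena.PercolationContinuityZ3.Theorems.PercBudgetLadderBudgetTightnessStubCeiling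
import Summits.CriticalPhenomena.PercolationContinuityZ3.Theorems.PercBudgetLadderBudgetTightnessStubTauLimit

/-!
# Line `Sketch` — skeleton for crux `BudgetTightness` (stmt-CriticalPhenomena-5248)

Lead: prover-line-stmt-CriticalPhenomena-5248-0 (rev 1, 2026-08-16); continuation lead
prover-line-stmt-CriticalPhenomena-5248-c1-0 (rev 3 = FINAL ASSEMBLED COPY, 2026-08-16T13:05Z: every landed stub is IMPORTED and discharged BY
NAME from `Theorems/PercBudgetLadderBudgetTightness{Stub*,CoreDensity}.lean`; the dictionary itself is landed as
`Theorems/PercBudgetLadderBudgetTightnessDictionary.lean` (p102875, registered stub `stub_dictionary`). Exactly TWO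
`sorry`s remain: `stub_core` (= the crux, by `stub_dictionary`) and `stub_coreDensity` (its necessary density half,
off the composition path). `lean check`: rc 0, sorries 2, `BudgetTightness_of` closes the crux modulo `stub_core` only.) Reshaped from the planners'
`Cruxes/BudgetTightness/SketchIdeator2.lean` (ideator 2, merged cards `slab-flow-constant-transfer` ⊇
`bk-first-moment-reduction`, both passed triage r1; the third card of that sketch,
`seeded-russo-pivotal-boost`, failed triage r1-2 as dominated and is NOT part of this line) and
`FirstMomentMarkov-ideator2.lean` (the proved Markov step, here `stub_markov`).

Route `PercBudgetLadder`, rung r2: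
`BudgetTightness : ∃ k l c, 2 ≤ l ∧ 0 < c ∧ ∀ N, ∃ n ≥ N, c ≤ P_{p_c(ℤ³)}(MinCut(n, l n) ≤ k)`,
the budget event being `{ω | ∃ S, #S ≤ k ∧ ¬ ∃ x ∈ B(n), ∃ y ∈ ∂ⁱⁿB(l n), ω \ S ∈ {x ↔ y in B(l n)}}`
`= {ω | minOpenCutIn B(l n) B(n) ∂ⁱⁿB(l n) ω ≤ k}` (`minOpenCutIn_le_iff`, verbatim).

OBJECTS (all stubs are DEF-FREE over tree declarations so that workers can land them verbatim under
`Theorems/`; the abbreviations below are only used in the prose):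
* `A(n, l)(ω) := minOpenCutIn ↑(box 3 (l n)) ↑(box 3 n) ↑(innerBoundary (zdGraph 3) (box 3 (l n))) ω`
  — the annulus min-cut budget `MinCut(n, l n) ∈ ℕ∞`;
* `Q(L, h) := Set.Icc ![0,0,0] ![L,L,h] ⊆ ℤ³` — the slab piece `[0,L]² × [0,h]`, with bottom layer
  `Set.Icc ![0,0,0] ![L,L,0]` and top layer `Set.Icc ![0,0,h] ![L,L,h]`;
  `S(L, h)(ω) := minOpenCutIn Q(L,h) bottom top ω` — its bottom-to-top min-cut;
* `E_p[·]` = `∫ (·).toNat ∂ bondPercolation (zdGraph 3) p` (the `ℕ∞` budgets are finite off a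
  degenerate geometry; `toNat ⊤ = 0` only matters there).

THE LINE (dictionary + open core):
* `stub_markov` (PROVED by ideator 2; Markov): `MeanCutBoundedIO(p_c) → BudgetTightness`, where
  `MeanCutBoundedIO(p) := ∃ l C, 2 ≤ l ∧ ∀ N, ∃ n ≥ N, E_p[A(n,l)] ≤ C`.
* `stub_sixLids` (six-lid routing + lattice isometries; provable now, size L): for `h ≥ 1`,
  `E_p[A(h+1, 2)] ≤ 6 · E_p[S(4h+4, h)]` — every open crossing of the annulus `B(h+1) → ∂ⁱⁿB(2h+2)`
  ends, after its last visit to `{±x_i ≤ h+1}`, with a bottom-to-top crossing of one of the six lid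
  pieces `{±x_i ≥ h+2} ∩ B(2h+2) ≅ Q(4h+4, h)`, so the union of six lid cutsets is an annulus cutset
  (`IsOpenCutsetIn.iUnion_of_routing`, a.s. on `ω ⊆ E(ℤ³)`), and `P_p` is invariant under the six
  isometries (`bondPercolation_map_relabel_iso`).
* `stub_core` (OPEN CORE = the card's transfer `C⁺ = SlabCutQuadraticIO(p_c)`): for some `C`, for
  infinitely many thicknesses `h`, `h² · E_{p_c}[S(L, h)] ≤ C · L²` for every `L ≥ h` — "Kesten's
  critical slab flow constant sits at its universal floor, `liminf_h h² τ_h(p_c) < ∞`".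
* `BudgetTightness_of` : core ⇒ (L = 4h+4) `E_{p_c}[S(4h+4,h)] ≤ 64 C` ⇒ (six lids)
  `E_{p_c}[A(h+1,2)] ≤ 384 C` i.o. ⇒ (Markov) the crux, BY NAME.
* CONVERSE (no loss — the dictionary is an equivalence), two more provable-now stubs:
  `stub_bkTail` (BK tail + Menger, size M/L): `P_p(A(n,l) ≤ k) ≥ c > 0 ⇒ E_p[A(n,l)] ≤ (k+1)/c`;
  `stub_patchCutset` (mid-plane patch routing + translation invariance, size L):
  `E_p[S(L, 2lm)] ≤ ⌈(L+1)/(2m+1)⌉² · E_p[A(m,l)]`; whence `line_dictionary : BudgetTightness →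
  SlabCutQuadraticIO(p_c)` (so `stub_core ⟺ BudgetTightness`, kernel-checked modulo the stubs).
* STRUCTURE of `h ↦ S(L,h)` for the attack on the core (provable now): `stub_thickMono`
  (antitone in the thickness, pointwise on lattice configurations, size S) and `stub_superadditive`
  (laterally superadditive, pointwise, size M: restriction of a cutset to vertex-disjoint full-height
  sub-pieces), which make `τ_h := sup_L E[S(L,h)]/L²` a genuine lateral limit, non-increasing in `h`.

Disproof.lean (cdisprove gen 1, tree @2026-08-16T05:37Z) honoured: no `_false_without_` theorem is
named; §3 (`budgetTightnessAt_antitone`, `budgetTightnessAt_one_false`,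
`not_budgetTightnessAt_of_criticalProb_lt`): every dictionary stub holds at EVERY `p` (they are
`∀ p`), so criticality enters only through `stub_core`, which is false at `p = 1` (`S(L,h)(E(ℤ³)) =
(L+1)²`: all vertical columns are disjoint crossings, `h²τ_h → ∞`) and for `p > p_c` exactly as the
crux; §5 (`not_tightAt_two_of_six_lt`): the composition lands at aspect `l = 2`, so by the Disproof a
proof of `stub_core` must use `d = 3` (barrier `SpanningClustersAboveSix` applies verbatim:
`h^{d-1} τ_h(p_c) → ∞` for `d ≥ 7` under `η = 0`); §2 degenerate geometry: `h = 0` (bottom = top,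
`S = ⊤`, `toNat ⊤ = 0`) is excluded by `1 ≤ h` in `stub_sixLids` and is harmless in `stub_core`
(`∀ H ∃ h ≥ H`); `n = 0`, `l ≤ 1` are excluded by hypotheses `1 ≤ n`, `2 ≤ l` (resp. `1 ≤ m`).
-/

noncomputable section

open MeasureTheory Filter Topology
open Literature.Probability.Percolation Literature.Probability.LatticeModels

namespace Summit.CriticalPhenomena.PercolationContinuityZ3.Cruxes.BudgetTightness.LineSketch

/-! ## Registered stubs (DEF-FREE statements over tree declarations) -/

/-- **stub_markov** (PROVED, ideator 2's `budgetTightness_of_meanCutBoundedIO'`; to be landed as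
`Theorems/PercBudgetLadderBudgetTightnessStubMarkov.lean`): a bounded expected critical annulus
min-cut along a subsequence gives the crux — stated here with the crux UNFOLDED (its definiens
verbatim), so that only `BudgetTightness_of` concludes the crux by name — by Markov's inequality at
level `k + 1 = ⌈2C⌉ + 1` (`l` kept, `c = 1/2`). -/
theorem stub_markov :
    (∃ (l : ℕ) (C : ℝ), 2 ≤ l ∧ ∀ N : ℕ, ∃ n : ℕ, N ≤ n ∧
      ∫ ω, ((minOpenCutIn (↑(box 3 (l * n)) : Set (Site 3)) (↑(box 3 n) : Set (Site 3))
        (↑(innerBoundary (zdGraph 3) (box 3 (l * n))) : Set (Site 3)) ω).toNat : ℝ)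
        ∂(bondPercolation (zdGraph 3) (criticalProbI 3)) ≤ C) →
      ∃ (k l : ℕ) (c : ℝ), 2 ≤ l ∧ 0 < c ∧ ∀ N : ℕ, ∃ n : ℕ, N ≤ n ∧
        c ≤ (bondPercolation (zdGraph 3) (criticalProbI 3)).real
          {ω | ∃ S : Finset (Sym2 (Site 3)), S.card ≤ k ∧
            ¬ ∃ x ∈ box 3 n, ∃ y ∈ innerBoundary (zdGraph 3) (box 3 (l * n)),
              (ω \ ↑S) ∈ openConnIn (↑(box 3 (l * n)) : Set (Site 3)) x y} :=
  _root_.Summit.CriticalPhenomena.PercolationContinuityZ3.Theorems.BudgetTightness.stub_markov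

/-- **stub_sixLids** (six-lid routing, provable now, size L): for every `p` and every thickness
`h ≥ 1`, `E_p[MinCut(h+1, 2h+2)] ≤ 6 · E_p[MinCut(Q(4h+4, h); bottom → top)]`. Proof route: (i) on
`ω ⊆ E(ℤ³)` every open walk inside `B(2h+2)` from `B(h+1)` to `∂ⁱⁿB(2h+2)` ends on a face
`{s x_i = 2h+2}` and, after its last visit to `{s x_i ≤ h+1}` (`PathIn.last_exit`,
`SitePaths.lean`), runs inside the lid `{s x_i ≥ h+2} ∩ B(2h+2)` from the layer `{s x_i = h+2}` to
the layer `{s x_i = 2h+2}`; so the union of optimal cutsets of the six lids is an open cutset of the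
annulus and `MinCut(annulus) ≤ Σ MinCut(lid)` a.s. (`IsOpenCutsetIn.iUnion_of_routing` /
`minOpenCutIn_le_sum_of_routing` restricted to lattice sub-configurations, `setBernoulli_ae_subset`);
(ii) each lid is the image of `Q(4h+4, h)` (with its bottom/top layers) under a lattice isometry
(`zdSignedPermIso`, `zdShiftIso` of `SiteConnectionTools.lean`), `minOpenCutIn` is transported by
bijections (`relabel_mem_openConnIn`, `LatticeSymmetry.lean`) and `P_p` is invariant
(`bondPercolation_map_relabel_iso`), so every lid has expected min-cut `E_p[S(4h+4, h)]`;
(iii) integrability: `MinCut ≤ #pairs` of the region (`minOpenCutIn_le_card`), measurability from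
`measurableSet_setOf_minOpenCutIn_le`. -/
theorem stub_sixLids :
    ∀ (p : unitInterval) (h : ℕ), 1 ≤ h →
      ∫ ω, ((minOpenCutIn (↑(box 3 (2 * (h + 1))) : Set (Site 3)) (↑(box 3 (h + 1)) : Set (Site 3))
          (↑(innerBoundary (zdGraph 3) (box 3 (2 * (h + 1)))) : Set (Site 3)) ω).toNat : ℝ)
          ∂(bondPercolation (zdGraph 3) p) ≤
      6 * ∫ ω, ((minOpenCutIn
          (Set.Icc (![0, 0, 0] : Site 3) ![((4 * h + 4 : ℕ) : ℤ), ((4 * h + 4 : ℕ) : ℤ), (h : ℤ)])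
          (Set.Icc (![0, 0, 0] : Site 3) ![((4 * h + 4 : ℕ) : ℤ), ((4 * h + 4 : ℕ) : ℤ), 0])
          (Set.Icc (![0, 0, (h : ℤ)] : Site 3) ![((4 * h + 4 : ℕ) : ℤ), ((4 * h + 4 : ℕ) : ℤ), (h : ℤ)])
          ω).toNat : ℝ) ∂(bondPercolation (zdGraph 3) p) :=
  _root_.Summit.CriticalPhenomena.PercolationContinuityZ3.Theorems.BudgetTightness.stub_sixLids

/-- **stub_core (OPEN CORE; `SlabCutQuadraticIO` at `p_c(ℤ³)`, size XL).** There is `C` such that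
for infinitely many thicknesses `h`, for every lateral size `L ≥ h`, the expected bottom-to-top
min-cut of the critical slab piece `Q(L,h) = [0,L]²×[0,h]` is at most `C L²/h²` — equivalently
`liminf_h h²·τ_h(p_c) < ∞` for Kesten's slab flow constant `τ_h = sup_L E[S(L,h)]/L²` (by
`stub_superadditive` a sup = lim). Sandwich known today: `c/h² ≤ τ_h(p_c) ≤ C·𝔥(h) → 0`
(finite-size criterion + square-root trick below; Rossignol–Théret 2018 Prop. 3.9 / Zhang 2000 with BGN
above). FALSE at `p = 1` and at every `p > p_c`, FALSE in `d ≥ 7` under `η = 0` (Aizenman 1997 Thm 4):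
a proof must use `p = p_c` exactly and `d = 3`. Numerically `h²τ_h(p_c) ≈ 0.62–0.68` for
`h = 8…64` (kit j008959/j011876/j011877). By `line_dictionary` below it is EQUIVALENT to the crux. -/
theorem stub_core :
    ∃ C : ℝ, ∀ H : ℕ, ∃ h : ℕ, H ≤ h ∧ ∀ L : ℕ, h ≤ L →
      (h : ℝ) ^ 2 * ∫ ω, ((minOpenCutIn
          (Set.Icc (![0, 0, 0] : Site 3) ![(L : ℤ), (L : ℤ), (h : ℤ)])
          (Set.Icc (![0, 0, 0] : Site 3) ![(L : ℤ), (L : ℤ), 0])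
          (Set.Icc (![0, 0, (h : ℤ)] : Site 3) ![(L : ℤ), (L : ℤ), (h : ℤ)])
          ω).toNat : ℝ) ∂(bondPercolation (zdGraph 3) (criticalProbI 3)) ≤ C * (L : ℝ) ^ 2 := by
  sorry

/-- **stub_bkTail** (BK geometric tail + Menger, provable now, size M/L): for `n ≥ 1`, `l ≥ 2`, if
`P_p(MinCut(n, l n) ≤ k) ≥ c > 0` then `E_p[MinCut(n, l n)] ≤ (k+1)/c`. Proof route: by Menger on the
finite region (`maxDisjointOpenPathsIn_eq_minOpenCutIn`, `MinOpenCutMenger.lean`) `MinCut = ν`, the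
maximal number of pairwise edge-disjoint open crossings; `{ν ≥ j(k+1)} ⊆ □^j {ν ≥ k+1}` (split
`j(k+1)` edge-disjoint open walks into `j` groups — disjoint witnesses, `mem_disjointOccurrenceList_of_pairwise_disjoint`,
the events `{ν ≥ t}` being increasing and finitary on the finite edge set of `B(l n)`), so
`P(ν ≥ j(k+1)) ≤ (1-c)^j` (`bk_finitary_list`, `BKFinitary.lean`) and
`E ν = Σ_{t ≥ 1} P(ν ≥ t) ≤ (k+1) Σ_j (1-c)^j = (k+1)/c`. -/
theorem stub_bkTail :
    ∀ (p : unitInterval) (n l k : ℕ) (c : ℝ), 1 ≤ n → 2 ≤ l → 0 < c →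
      c ≤ (bondPercolation (zdGraph 3) p).real
        {ω | minOpenCutIn (↑(box 3 (l * n)) : Set (Site 3)) (↑(box 3 n) : Set (Site 3))
          (↑(innerBoundary (zdGraph 3) (box 3 (l * n))) : Set (Site 3)) ω ≤ k} →
      ∫ ω, ((minOpenCutIn (↑(box 3 (l * n)) : Set (Site 3)) (↑(box 3 n) : Set (Site 3))
          (↑(innerBoundary (zdGraph 3) (box 3 (l * n))) : Set (Site 3)) ω).toNat : ℝ)
          ∂(bondPercolation (zdGraph 3) p) ≤ ((k : ℝ) + 1) / c :=
  _root_.Summit.CriticalPhenomena.PercolationContinuityZ3.Theorems.BudgetTightness.stub_bkTail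

/-- **stub_patchCutset** (mid-plane patch routing + translation invariance, provable now, size L):
for `m ≥ 1`, `l ≥ 2` and every `L`, `E_p[S(L, 2lm)] ≤ ⌈(L+1)/(2m+1)⌉² · E_p[MinCut(m, l m)]`
(`⌈(L+1)/(2m+1)⌉ = (L + 2m + 1)/(2m+1)` in `ℕ`). Proof route: the mid layer `{x_2 = lm}` of `Q(L, 2lm)`
is covered by the `⌈(L+1)/(2m+1)⌉²` translates `c + B(m)`, `c = ((2m+1)a + m, (2m+1)b + m, lm)`; on
`ω ⊆ E(ℤ³)` an open bottom-to-top walk of `Q(L,2lm)` visits that layer at some `v ∈ c + B(m)` and from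
`v` either first leaves `c + B(lm)` through a vertex of `c + ∂ⁱⁿB(lm)` (`PathIn.exit`) or ends on the
top layer `{x_2 = 2lm} ∩ (c + B(lm)) ⊆ c + ∂ⁱⁿB(lm)`, staying inside `c + B(lm)` meanwhile; so the
union of optimal cutsets of the translated annuli `c + (B(m) → ∂ⁱⁿB(lm) in B(lm))` is an open
cutset of the piece (`IsOpenCutsetIn.iUnion_of_routing`, a.s.), and each translated annulus has
expected min-cut `E_p[MinCut(m, l m)]` (`bondPercolation_map_shift`, transport of `minOpenCutIn`
under `zdShiftIso`). -/
theorem stub_patchCutset :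
    ∀ (p : unitInterval) (m l L : ℕ), 1 ≤ m → 2 ≤ l →
      ∫ ω, ((minOpenCutIn
          (Set.Icc (![0, 0, 0] : Site 3) ![(L : ℤ), (L : ℤ), ((2 * l * m : ℕ) : ℤ)])
          (Set.Icc (![0, 0, 0] : Site 3) ![(L : ℤ), (L : ℤ), 0])
          (Set.Icc (![0, 0, ((2 * l * m : ℕ) : ℤ)] : Site 3) ![(L : ℤ), (L : ℤ), ((2 * l * m : ℕ) : ℤ)])
          ω).toNat : ℝ) ∂(bondPercolation (zdGraph 3) p) ≤
      ((((L + 2 * m + 1) / (2 * m + 1) : ℕ) : ℝ)) ^ 2 *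
        ∫ ω, ((minOpenCutIn (↑(box 3 (l * m)) : Set (Site 3)) (↑(box 3 m) : Set (Site 3))
          (↑(innerBoundary (zdGraph 3) (box 3 (l * m))) : Set (Site 3)) ω).toNat : ℝ)
          ∂(bondPercolation (zdGraph 3) p) :=
  _root_.Summit.CriticalPhenomena.PercolationContinuityZ3.Theorems.BudgetTightness.stub_patchCutset

/-- **stub_thickMono** (antitone in the thickness, provable now, size S): on a lattice configuration,
`S(L, h+1)(ω) ≤ S(L, h)(ω)` — an open cutset `T` of `Q(L,h)` (bottom → top layer `h`) is one of
`Q(L,h+1)` (bottom → top layer `h+1`): an open bottom-to-top walk of `Q(L,h+1)` avoiding `T` first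
leaves `{x_2 ≤ h}` (`PathIn.exit`, `SitePaths.lean`) along a lattice edge from the layer `{x_2 = h}`,
and its initial segment is an open walk of `Q(L,h)` from the bottom to that layer avoiding `T`.
(For `h = 0` the right side is `⊤`.) Needs `ω ⊆ E(ℤ³)`: a non-lattice pair could jump layers. -/
theorem stub_thickMono :
    ∀ (L h : ℕ) (ω : BondConfig (Site 3)), ω ⊆ (zdGraph 3).edgeSet →
      minOpenCutIn
          (Set.Icc (![0, 0, 0] : Site 3) ![(L : ℤ), (L : ℤ), ((h + 1 : ℕ) : ℤ)])
          (Set.Icc (![0, 0, 0] : Site 3) ![(L : ℤ), (L : ℤ), 0])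
          (Set.Icc (![0, 0, ((h + 1 : ℕ) : ℤ)] : Site 3) ![(L : ℤ), (L : ℤ), ((h + 1 : ℕ) : ℤ)]) ω ≤
      minOpenCutIn
          (Set.Icc (![0, 0, 0] : Site 3) ![(L : ℤ), (L : ℤ), (h : ℤ)])
          (Set.Icc (![0, 0, 0] : Site 3) ![(L : ℤ), (L : ℤ), 0])
          (Set.Icc (![0, 0, (h : ℤ)] : Site 3) ![(L : ℤ), (L : ℤ), (h : ℤ)]) ω :=
  _root_.Summit.CriticalPhenomena.PercolationContinuityZ3.Theorems.BudgetTightness.stub_thickMono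

/-- **stub_superadditive** (lateral superadditivity, provable now, size M; pointwise, every
configuration): the `k²` pieces `Q_{a,b} = ((L+1)a, (L+1)b, 0) + Q(L,h)`, `a, b < k`, are pairwise
vertex-disjoint full-height sub-pieces of `Q(k(L+1)-1, h)`; if `T` is an optimal open cutset of the
big piece then `T ∩ Sym2(Q_{a,b})` is an open cutset of `Q_{a,b}` (an open bottom-to-top walk of
`Q_{a,b}` avoiding it avoids `T` and is a bottom-to-top walk of the big piece), and these restrictions
are pairwise disjoint, so `Σ_{a,b} S(Q_{a,b}) ≤ #T = S(Q(k(L+1)-1, h))` (`minOpenCutIn_le_card`,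
`exists_eq_minOpenCutIn`; if the big min-cut is `⊤` there is nothing to prove). -/
theorem stub_superadditive :
    ∀ (L h k : ℕ) (ω : BondConfig (Site 3)),
      ∑ a ∈ Finset.range k, ∑ b ∈ Finset.range k,
        minOpenCutIn
          (Set.Icc (![(((L + 1) * a : ℕ) : ℤ), (((L + 1) * b : ℕ) : ℤ), 0] : Site 3)
            ![(((L + 1) * a + L : ℕ) : ℤ), (((L + 1) * b + L : ℕ) : ℤ), (h : ℤ)])
          (Set.Icc (![(((L + 1) * a : ℕ) : ℤ), (((L + 1) * b : ℕ) : ℤ), 0] : Site 3)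
            ![(((L + 1) * a + L : ℕ) : ℤ), (((L + 1) * b + L : ℕ) : ℤ), 0])
          (Set.Icc (![(((L + 1) * a : ℕ) : ℤ), (((L + 1) * b : ℕ) : ℤ), (h : ℤ)] : Site 3)
            ![(((L + 1) * a + L : ℕ) : ℤ), (((L + 1) * b + L : ℕ) : ℤ), (h : ℤ)]) ω ≤
      minOpenCutIn
          (Set.Icc (![0, 0, 0] : Site 3)
            ![((k * (L + 1) - 1 : ℕ) : ℤ), ((k * (L + 1) - 1 : ℕ) : ℤ), (h : ℤ)])
          (Set.Icc (![0, 0, 0] : Site 3)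
            ![((k * (L + 1) - 1 : ℕ) : ℤ), ((k * (L + 1) - 1 : ℕ) : ℤ), 0])
          (Set.Icc (![0, 0, (h : ℤ)] : Site 3)
            ![((k * (L + 1) - 1 : ℕ) : ℤ), ((k * (L + 1) - 1 : ℕ) : ℤ), (h : ℤ)]) ω :=
  _root_.Summit.CriticalPhenomena.PercolationContinuityZ3.Theorems.BudgetTightness.stub_superadditive

/-! ## Cycle-2 stubs: the FLOOR of the core (sharpness of `SlabCutQuadraticIO`; first lemma
`slabCutMean_lower` of the picked card). Not on the composition path to the crux: they prove that the
core's order `L²/h²` cannot be improved (`c ≤ h²·E_{p_c}[S(L,h)]/L²`), so that the crux reads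
"the floor is attained infinitely often". -/

/-- **stub_critCrossing (finite-size criterion at `p_c(ℤ³)`, provable now, size L).** There is
`ε > 0` such that for EVERY `m ≥ 1` the critical annulus `B(m) → ∂ⁱⁿB(2m)` is crossed inside `B(2m)`
with probability at least `ε` (the event is verbatim the complement of the route's blocked event at
aspect `l = 2`, and equals `annulusCrossing 3 m` of `Theorems/SubpolynomialBlocking/Negative/OffCritical.lean`).
Proof route (Kesten 1982 Thm 5.1 / Hammersley-type renormalisation; [cite: Kesten1982, Thm. 5.1]):
with `u(m) := P_{p_c}(B(m) ↔ ∂ⁱⁿB(2m) in B(2m))`, an open lattice path from `B(8m)` to `∂ⁱⁿB(16m)`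
meets the sphere `{‖z‖_∞ = 10m}` at a vertex of some `x₁ + B(m)`, `x₁` in an `m`-net `N₁` of that
sphere, and then leaves `x₁ + B(2m)` (realising `x₁ + {B(m) ↔ ∂ⁱⁿB(2m) in B(2m)}`, edges inside
`{8m ≤ ‖z‖ ≤ 12m}`), and it ends at a vertex of some `x₂ + B(m)`, `x₂` in an `m`-net `N₂` of
`{‖z‖ = 16m}`, having entered `x₂ + B(2m) ⊆ {‖z‖ ≥ 14m}` from outside (realising the translate at
`x₂`, edges inside `{‖z‖ ≥ 14m}`); the two translated events are independent
(`bondPercolation_real_inter_of_disjoint`, disjoint edge sets) and equiprobable with `u(m)`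
(`bondPercolation_real_preimage_shift`), so `u(8m) ≤ K·u(m)²` with `K = #N₁·#N₂` an absolute
constant. If `u(m₀) < 1/K` for one `m₀` then `K u(8^j m₀) ≤ (K u(m₀))^{2^j}`, a super-polynomial
decay of `P_{p_c}(0 ↔ ∂ⁱⁿB(2·8^j m₀)) ≤ u(8^j m₀)`, contradicting the polynomial lower bound
`P_{p_c}(0 ↔ ∂ⁱⁿB(N) in B(N)) ≥ 1/(p_c · 6 · #∂ⁱⁿB(N)) ≥ c/N²` that follows from `φ_{p_c}(B(N)) ≥ 1`
(`Literature.Barriers.CriticalPhenomena.one_le_phi_criticalProbI`, Duminil-Copin–Tassion 2016 /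
Kozma–Nachmias 2011 Lemma 3.1, in tree). Hence `u(m) ≥ 1/K` for all `m ≥ 1`. -/
theorem stub_critCrossing :
    ∃ ε : ℝ, 0 < ε ∧ ∀ m : ℕ, 1 ≤ m →
      ε ≤ (bondPercolation (zdGraph 3) (criticalProbI 3)).real
        {ω | ∃ x ∈ box 3 m, ∃ y ∈ innerBoundary (zdGraph 3) (box 3 (2 * m)),
          ω ∈ openConnIn (↑(box 3 (2 * m)) : Set (Site 3)) x y} :=
  _root_.Summit.CriticalPhenomena.PercolationContinuityZ3.Theorems.BudgetTightness.stub_critCrossing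

/-- (LANDED p99262 as `…Theorems.BudgetTightness.stub_floor`, self-contained file
`Theorems/PercBudgetLadderBudgetTightnessStubFloor.lean`.) **stub_floor (the universal floor `τ_h(p_c) ≥ c/h²`, provable now given `stub_critCrossing`,
size M).** If critical aspect-2 annuli are crossed with probability `≥ ε` at every scale, then for
every thickness `h ≥ 1` and every lateral size `L ≥ 18h`, `c·L² ≤ h²·E_{p_c}[S(L,h)]` with
`c = ε/1944`. Proof route: a crossing of the annulus `B(h+1) → ∂ⁱⁿB(2h+2)` inside `B(2h+2)` contains a
bottom-to-top crossing of one of the six lid pieces `≅ Q(4h+4, h)`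
(`Theorems.BudgetTightness.StubSixLids.routing`), so by a union bound and lattice symmetry
(`bondPercolation_real_image` / `bondPercolation_real_preimage_relabel_iso`)
`P_{p_c}(Q(4h+4,h) crossed bottom-top) ≥ ε/6`, hence `E_{p_c}[S(4h+4,h)] ≥ ε/6` (`S ≥ 1` on the
crossing event, `minOpenCutIn_eq_zero_iff`); superadditivity (`stub_superadditive`, blocks of side
`4h+5`, each a translate of `Q(4h+4,h)` with the same expectation by `integral_toNat_minOpenCutIn_shift`)
gives `E[S(k(4h+5)-1, h)] ≥ k²ε/6`, and monotonicity in `L` (`StubSuperadditive.sum_minOpenCutIn_le` with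
one block) extends to every `L ≥ 18h` with `k = (L+1)/(4h+5) ≥ (L+1)/(2(4h+5))`, `4h+5 ≤ 9h`. -/
theorem stub_floor :
    (∃ ε : ℝ, 0 < ε ∧ ∀ m : ℕ, 1 ≤ m →
      ε ≤ (bondPercolation (zdGraph 3) (criticalProbI 3)).real
        {ω | ∃ x ∈ box 3 m, ∃ y ∈ innerBoundary (zdGraph 3) (box 3 (2 * m)),
          ω ∈ openConnIn (↑(box 3 (2 * m)) : Set (Site 3)) x y}) →
    ∃ c : ℝ, 0 < c ∧ ∀ h : ℕ, 1 ≤ h → ∀ L : ℕ, 18 * h ≤ L →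
      c * (L : ℝ) ^ 2 ≤ (h : ℝ) ^ 2 * ∫ ω, ((minOpenCutIn
          (Set.Icc (![0, 0, 0] : Site 3) ![(L : ℤ), (L : ℤ), (h : ℤ)])
          (Set.Icc (![0, 0, 0] : Site 3) ![(L : ℤ), (L : ℤ), 0])
          (Set.Icc (![0, 0, (h : ℤ)] : Site 3) ![(L : ℤ), (L : ℤ), (h : ℤ)])
          ω).toNat : ℝ) ∂(bondPercolation (zdGraph 3) (criticalProbI 3)) :=
  _root_.Summit.CriticalPhenomena.PercolationContinuityZ3.Theorems.BudgetTightness.stub_floor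

/-- **The floor, composed** (kernel-checked modulo `stub_critCrossing`, `stub_floor`): for some
`c > 0`, `c·L² ≤ h²·E_{p_c}[S(L,h)]` for all `h ≥ 1`, `L ≥ 18h` — the core's bound `C·L²` is sharp in
order, and `BudgetTightness ⟺` the floor is attained along a subsequence of thicknesses. -/
theorem floor :
    ∃ c : ℝ, 0 < c ∧ ∀ h : ℕ, 1 ≤ h → ∀ L : ℕ, 18 * h ≤ L →
      c * (L : ℝ) ^ 2 ≤ (h : ℝ) ^ 2 * ∫ ω, ((minOpenCutIn
          (Set.Icc (![0, 0, 0] : Site 3) ![(L : ℤ), (L : ℤ), (h : ℤ)])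
          (Set.Icc (![0, 0, 0] : Site 3) ![(L : ℤ), (L : ℤ), 0])
          (Set.Icc (![0, 0, (h : ℤ)] : Site 3) ![(L : ℤ), (L : ℤ), (h : ℤ)])
          ω).toNat : ℝ) ∂(bondPercolation (zdGraph 3) (criticalProbI 3)) :=
  stub_floor stub_critCrossing

/-! ## Cycle-2 (lead c1) stubs: the CEILING in slab coordinates and the lateral limit `τ_h(p)`.
Not on the composition path: with `stub_floor` they complete the sandwich
`c/h² ≤ τ_h(p_c) ≤ 𝔥(h-1)` (`𝔥(r) = P_{p_c}(armH r)`, the half-space one-arm probability of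
`PercLowPointHalfSpace.QuantitativeBGN` / `PercBudgetLadder.DefectDimensionOfQuantBGN`, verbatim) and make
`τ_h(p) = lim_L E_p[S(L,h)]/(L+1)² = sup_L …` a genuine object, so that the core reads
`liminf_h h²·τ_h(p_c) < ∞` literally. -/

/-- (LANDED p97941 as `…Theorems.BudgetTightness.stub_ceiling`,
`Theorems/PercBudgetLadderBudgetTightnessStubCeiling.lean`.) **stub_ceiling (level cutset / Rossignol–Théret in slab form, provable now, size M).** For every
`p`, `L`, `h`: `E_p[S(L, h+1)] ≤ (L+1)² · P_p(armH h)`, where `armH h = {∃ y, ‖y‖∞ ≥ h ∧ 0 ↔ y in ℍ}`,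
`ℍ = {x | 0 ≤ x 0}` (written out; verbatim `Theorems.QuantitativeBGN.Negative.armH h`). Proof route: on a
lattice configuration `ω ⊆ E(ℤ³)` an open bottom-to-top walk of `Q(L,h+1)` has a LAST vertex `u = (a,b,0)`
on the bottom layer; its next step is the vertical lattice edge to `v = (a,b,1)` (the walk stays in `Q`, so
`z ≥ 0`, and never returns to `z = 0`), and its remainder joins `v` to the top layer `{z = h+1}` inside
`Q ∩ {1 ≤ z}`; hence `T(ω) = {s((a,b,0),(a,b,1)) : (a,b,1) joined to the top inside Q ∩ {1 ≤ z}}` is an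
open cutset (`PathIn.last_exit` / `SimpleGraph.Walk` reversal, `SitePaths.lean`), `S(L,h+1) ≤ #T ≤
Σ_{(a,b)} 𝟙{(a,b,1) ↔ top in Q ∩ {1 ≤ z}}` a.s. (`setBernoulli_ae_subset`), and each indicator has
probability `≤ P_p(armH h)` by the lattice symmetry `faceIso` (`(a,b,1) ↦ 0`, the `z`-axis to the
`x₀`-axis: `Q ∩ {1 ≤ z} ↦ ⊆ ℍ`, top layer ↦ `{x₀ = h}`; `bondPercolation_real_preimage_relabel_iso`,
`relabel_mem_openConnIn`, cf. `ZhangBaseTools.real_setOf_joined_le_armH`). With BGN (`P_{p_c}(armH h) → 0`,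
`QuantitativeBGN/Negative/LoadBearing.tendsto_armH_criticalProb`) this is Zhang's `τ_h(p_c) → 0`; with a
rate `P_{p_c}(armH h) ≤ C h^{-a}` it gives `h²τ_h(p_c) ≤ C h^{2-a}` — the core needs `a ≥ 2`, numerically
`a ≈ 1` (level cutsets cannot prove the core). -/
theorem stub_ceiling :
    ∀ (p : unitInterval) (L h : ℕ),
      ∫ ω, ((minOpenCutIn
          (Set.Icc (![0, 0, 0] : Site 3) ![(L : ℤ), (L : ℤ), ((h + 1 : ℕ) : ℤ)])
          (Set.Icc (![0, 0, 0] : Site 3) ![(L : ℤ), (L : ℤ), 0])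
          (Set.Icc (![0, 0, ((h + 1 : ℕ) : ℤ)] : Site 3) ![(L : ℤ), (L : ℤ), ((h + 1 : ℕ) : ℤ)])
          ω).toNat : ℝ) ∂(bondPercolation (zdGraph 3) p) ≤
      ((L : ℝ) + 1) ^ 2 * (bondPercolation (zdGraph 3) p).real
        {ω | ∃ y : Site 3, (∃ i : Fin 3, (h : ℤ) ≤ |y i|) ∧
          ω ∈ openConnIn {x : Site 3 | 0 ≤ x 0} 0 y} :=
  _root_.Summit.CriticalPhenomena.PercolationContinuityZ3.Theorems.BudgetTightness.stub_ceiling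

/-- (LANDED p100046 as `…Theorems.BudgetTightness.stub_tauLimit`,
`Theorems/PercBudgetLadderBudgetTightnessStubTauLimit.lean`.) **stub_tauLimit (the slab flow constant exists as a lateral limit = supremum, provable now, size M).**
For every `p` and `h` there is `τ = τ_h(p) ∈ ℝ` with `E_p[S(L,h)] ≤ τ·(L+1)²` for EVERY `L` and
`E_p[S(L,h)]/(L+1)² → τ` as `L → ∞`. Proof route (Fekete in two dimensions with monotonicity): with
`f(L) = E_p[S(L,h)]`, (i) `f` is non-decreasing in `L` (`minOpenCutIn_mono_set/left/right`: a cutset of the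
bigger piece is one of the smaller), (ii) `k²·f(L) ≤ f(k(L+1)-1)` (`stub_superadditive` +
`StubPatchCutset.integral_toNat_minOpenCutIn_shift`: the `k²` blocks are translates of `Q(L,h)`),
(iii) `0 ≤ f(L) ≤ (L+1)²` (a.s. the `(L+1)²` vertical lattice edges between the layers `z = 0` and `z = 1`
form an open cutset when `h ≥ 1`; for `h = 0` the budget is `⊤`, `toNat ⊤ = 0`, `f = 0`), so
`τ := sup_L f(L)/(L+1)² ≤ 1` exists; (iv) for `N + 1 = k(L+1) + r`, `0 ≤ r ≤ L`:
`f(N)/(N+1)² ≥ k² f(L)/(k(L+1)+L)² → f(L)/(L+1)²` as `N → ∞`, so `liminf ≥ sup ≥ limsup`. Makes the core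
read `liminf_h h²·τ_h(p_c) < ∞` (its clause `∀ L ≥ h` is then automatic from the `sup` property). -/
theorem stub_tauLimit :
    ∀ (p : unitInterval) (h : ℕ), ∃ τ : ℝ,
      (∀ L : ℕ, ∫ ω, ((minOpenCutIn
          (Set.Icc (![0, 0, 0] : Site 3) ![(L : ℤ), (L : ℤ), (h : ℤ)])
          (Set.Icc (![0, 0, 0] : Site 3) ![(L : ℤ), (L : ℤ), 0])
          (Set.Icc (![0, 0, (h : ℤ)] : Site 3) ![(L : ℤ), (L : ℤ), (h : ℤ)])
          ω).toNat : ℝ) ∂(bondPercolation (zdGraph 3) p) ≤ τ * ((L : ℝ) + 1) ^ 2) ∧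
      Filter.Tendsto (fun L : ℕ => (∫ ω, ((minOpenCutIn
          (Set.Icc (![0, 0, 0] : Site 3) ![(L : ℤ), (L : ℤ), (h : ℤ)])
          (Set.Icc (![0, 0, 0] : Site 3) ![(L : ℤ), (L : ℤ), 0])
          (Set.Icc (![0, 0, (h : ℤ)] : Site 3) ![(L : ℤ), (L : ℤ), (h : ℤ)])
          ω).toNat : ℝ) ∂(bondPercolation (zdGraph 3) p)) / ((L : ℝ) + 1) ^ 2)
        Filter.atTop (nhds τ) :=
  _root_.Summit.CriticalPhenomena.PercolationContinuityZ3.Theorems.BudgetTightness.stub_tauLimit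

/-- **The core in `τ_h` language (no `sorry` of its own; hypotheses = the statements of `stub_tauLimit`
and `stub_core` verbatim):** along the core's thicknesses, `h² · τ_h(p_c) ≤ C` — the lateral limit
inherits the bound (`le_of_tendsto`, `L ≥ h` eventually). -/
theorem hsq_tau_le_of_core
    (hT : ∀ (p : unitInterval) (h : ℕ), ∃ τ : ℝ,
      (∀ L : ℕ, ∫ ω, ((minOpenCutIn
          (Set.Icc (![0, 0, 0] : Site 3) ![(L : ℤ), (L : ℤ), (h : ℤ)])
          (Set.Icc (![0, 0, 0] : Site 3) ![(L : ℤ), (L : ℤ), 0])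
          (Set.Icc (![0, 0, (h : ℤ)] : Site 3) ![(L : ℤ), (L : ℤ), (h : ℤ)])
          ω).toNat : ℝ) ∂(bondPercolation (zdGraph 3) p) ≤ τ * ((L : ℝ) + 1) ^ 2) ∧
      Filter.Tendsto (fun L : ℕ => (∫ ω, ((minOpenCutIn
          (Set.Icc (![0, 0, 0] : Site 3) ![(L : ℤ), (L : ℤ), (h : ℤ)])
          (Set.Icc (![0, 0, 0] : Site 3) ![(L : ℤ), (L : ℤ), 0])
          (Set.Icc (![0, 0, (h : ℤ)] : Site 3) ![(L : ℤ), (L : ℤ), (h : ℤ)])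
          ω).toNat : ℝ) ∂(bondPercolation (zdGraph 3) p)) / ((L : ℝ) + 1) ^ 2)
        Filter.atTop (nhds τ))
    (hC : ∃ C : ℝ, ∀ H : ℕ, ∃ h : ℕ, H ≤ h ∧ ∀ L : ℕ, h ≤ L →
      (h : ℝ) ^ 2 * ∫ ω, ((minOpenCutIn
          (Set.Icc (![0, 0, 0] : Site 3) ![(L : ℤ), (L : ℤ), (h : ℤ)])
          (Set.Icc (![0, 0, 0] : Site 3) ![(L : ℤ), (L : ℤ), 0])
          (Set.Icc (![0, 0, (h : ℤ)] : Site 3) ![(L : ℤ), (L : ℤ), (h : ℤ)])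
          ω).toNat : ℝ) ∂(bondPercolation (zdGraph 3) (criticalProbI 3)) ≤ C * (L : ℝ) ^ 2) :
    ∃ C : ℝ, ∀ H : ℕ, ∃ h : ℕ, H ≤ h ∧ ∃ τ : ℝ,
      Filter.Tendsto (fun L : ℕ => (∫ ω, ((minOpenCutIn
          (Set.Icc (![0, 0, 0] : Site 3) ![(L : ℤ), (L : ℤ), (h : ℤ)])
          (Set.Icc (![0, 0, 0] : Site 3) ![(L : ℤ), (L : ℤ), 0])
          (Set.Icc (![0, 0, (h : ℤ)] : Site 3) ![(L : ℤ), (L : ℤ), (h : ℤ)])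
          ω).toNat : ℝ) ∂(bondPercolation (zdGraph 3) (criticalProbI 3))) / ((L : ℝ) + 1) ^ 2)
        Filter.atTop (nhds τ) ∧ (h : ℝ) ^ 2 * τ ≤ C := by
  obtain ⟨C, hcore⟩ := hC
  refine ⟨C, fun H => ?_⟩
  obtain ⟨h, hHh, hL⟩ := hcore H
  obtain ⟨τ, -, hτ⟩ := hT (criticalProbI 3) h
  refine ⟨h, hHh, τ, hτ, ?_⟩
  -- `h² · f(L)/(L+1)² ≤ C · L²/(L+1)² ≤ C` for `L ≥ h`, and the left side tends to `h² τ`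
  have hlim : Filter.Tendsto (fun L : ℕ => (h : ℝ) ^ 2 * ((∫ ω, ((minOpenCutIn
          (Set.Icc (![0, 0, 0] : Site 3) ![(L : ℤ), (L : ℤ), (h : ℤ)])
          (Set.Icc (![0, 0, 0] : Site 3) ![(L : ℤ), (L : ℤ), 0])
          (Set.Icc (![0, 0, (h : ℤ)] : Site 3) ![(L : ℤ), (L : ℤ), (h : ℤ)])
          ω).toNat : ℝ) ∂(bondPercolation (zdGraph 3) (criticalProbI 3))) / ((L : ℝ) + 1) ^ 2))
        Filter.atTop (nhds ((h : ℝ) ^ 2 * τ)) := hτ.const_mul _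
  refine le_of_tendsto hlim (Filter.eventually_atTop.2 ⟨max h 1, fun L hLh => ?_⟩)
  have hLh' : h ≤ L := le_trans (le_max_left _ _) hLh
  have hL1 : (1 : ℝ) ≤ L := by exact_mod_cast le_trans (le_max_right _ _) hLh
  have hpos : (0 : ℝ) < ((L : ℝ) + 1) ^ 2 := by positivity
  have hI0 : 0 ≤ ∫ ω, ((minOpenCutIn
          (Set.Icc (![0, 0, 0] : Site 3) ![(L : ℤ), (L : ℤ), (h : ℤ)])
          (Set.Icc (![0, 0, 0] : Site 3) ![(L : ℤ), (L : ℤ), 0])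
          (Set.Icc (![0, 0, (h : ℤ)] : Site 3) ![(L : ℤ), (L : ℤ), (h : ℤ)])
          ω).toNat : ℝ) ∂(bondPercolation (zdGraph 3) (criticalProbI 3)) :=
    integral_nonneg fun ω => by positivity
  have h1 := hL L hLh'
  have hC0 : 0 ≤ C := by
    have hL2 : (0 : ℝ) < (L : ℝ) ^ 2 := by positivity
    have : 0 ≤ C * (L : ℝ) ^ 2 := le_trans (by positivity) h1
    exact nonneg_of_mul_nonneg_left this hL2
  rw [mul_div_assoc', div_le_iff₀ hpos]
  calc (h : ℝ) ^ 2 * ∫ ω, ((minOpenCutIn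
          (Set.Icc (![0, 0, 0] : Site 3) ![(L : ℤ), (L : ℤ), (h : ℤ)])
          (Set.Icc (![0, 0, 0] : Site 3) ![(L : ℤ), (L : ℤ), 0])
          (Set.Icc (![0, 0, (h : ℤ)] : Site 3) ![(L : ℤ), (L : ℤ), (h : ℤ)])
          ω).toNat : ℝ) ∂(bondPercolation (zdGraph 3) (criticalProbI 3))
      ≤ C * (L : ℝ) ^ 2 := h1
    _ ≤ C * ((L : ℝ) + 1) ^ 2 := by gcongr; linarith

/-! ## The DENSITY half of the core (registered rev 1b; necessary for the core, kernel-checked below) -/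

/-- **stub_numCrossingLe** (LANDED p92843, `Theorems/PercBudgetLadderBudgetTightnessCoreDensity.lean`):
for every finite region of `ℤ³`, the number of open clusters (components of the open graph induced on the
region) meeting both `A` and `B` is at most `MinCut_S(A,B)` (one open walk per component, vertex-disjoint,
weak duality). -/
theorem stub_numCrossingLe :
    ∀ (S A B : Set (Site 3)), S.Finite → ∀ ω : BondConfig (Site 3),
      {c : ((openGraph ω).induce S).ConnectedComponent |
        (∃ x : S, (x : Site 3) ∈ A ∧ ((openGraph ω).induce S).connectedComponentMk x = c) ∧
        ∃ y : S, (y : Site 3) ∈ B ∧ ((openGraph ω).induce S).connectedComponentMk y = c}.encard ≤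
      minOpenCutIn S A B ω :=
  _root_.Summit.CriticalPhenomena.PercolationContinuityZ3.Theorems.BudgetTightness.stub_numCrossingLe

/-- **stub_coreDensity (OPEN; the DENSITY half of the core, size XL).** There is `C` such that for
infinitely many thicknesses `h`, for every `L ≥ h`, `h² · E_{p_c}[N(L,h)] ≤ C · L²`, where `N(L,h)(ω)` is
the number of open clusters of the piece `Q(L,h) = [0,L]²×[0,h]` (components of the open graph induced on
it) meeting both its bottom and its top layer — the slab form of "tight spanning-cluster number"
(hyperscaling, `d < 6`; Aizenman 1997 proves the `d = 2` case by RSW, BCKS 1999 is conditional; FALSE in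
`d ≥ 7` under `η = 0`). NECESSARY for `stub_core` (`coreDensity_of_core`, kernel-checked: distinct
crossing clusters carry edge-disjoint crossings); numerically `h²·E[N]/L² ≈ 0.42–0.47`, flat for
`h = 16…160` (kit j015800). Not on the composition path; registered as the disprover's target: killing it
kills the core and, through the dictionary, the crux. -/
theorem stub_coreDensity :
    ∃ C : ℝ, ∀ H : ℕ, ∃ h : ℕ, H ≤ h ∧ ∀ L : ℕ, h ≤ L →
      (h : ℝ) ^ 2 * ∫ ω, (({c : ((openGraph ω).induce
          (Set.Icc (![0, 0, 0] : Site 3) ![(L : ℤ), (L : ℤ), (h : ℤ)])).ConnectedComponent |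
        (∃ x : ↥(Set.Icc (![0, 0, 0] : Site 3) ![(L : ℤ), (L : ℤ), (h : ℤ)]),
          (x : Site 3) ∈ Set.Icc (![0, 0, 0] : Site 3) ![(L : ℤ), (L : ℤ), 0] ∧
          ((openGraph ω).induce (Set.Icc (![0, 0, 0] : Site 3) ![(L : ℤ), (L : ℤ), (h : ℤ)])).connectedComponentMk x = c) ∧
        ∃ y : ↥(Set.Icc (![0, 0, 0] : Site 3) ![(L : ℤ), (L : ℤ), (h : ℤ)]),
          (y : Site 3) ∈ Set.Icc (![0, 0, (h : ℤ)] : Site 3) ![(L : ℤ), (L : ℤ), (h : ℤ)] ∧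
          ((openGraph ω).induce (Set.Icc (![0, 0, 0] : Site 3) ![(L : ℤ), (L : ℤ), (h : ℤ)])).connectedComponentMk y = c}.encard).toNat : ℝ)
        ∂(bondPercolation (zdGraph 3) (criticalProbI 3)) ≤ C * (L : ℝ) ^ 2 := by
  sorry

/-- Bottom and top layer of `Q(L,h)` are disjoint for `h ≥ 1`, so the slab budget is finite
(`minOpenCutIn_eq_top_iff_of_finite`). -/
theorem slabBudget_ne_top {L h : ℕ} (hh : 1 ≤ h) (ω : BondConfig (Site 3)) :
    minOpenCutIn (Set.Icc (![0, 0, 0] : Site 3) ![(L : ℤ), (L : ℤ), (h : ℤ)])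
      (Set.Icc (![0, 0, 0] : Site 3) ![(L : ℤ), (L : ℤ), 0])
      (Set.Icc (![0, 0, (h : ℤ)] : Site 3) ![(L : ℤ), (L : ℤ), (h : ℤ)]) ω ≠ ⊤ := by
  rw [Ne, minOpenCutIn_eq_top_iff_of_finite (Set.finite_Icc _ _)]
  rintro ⟨a, -, ha, ha'⟩
  have h1 := (Set.mem_Icc.1 ha).2 2
  have h2 := (Set.mem_Icc.1 ha').1 2
  simp only [Matrix.cons_val] at h1 h2
  omega

/-- **The density half is NECESSARY for the core** (sorry-free; hypothesis = the statement of
`stub_core` verbatim, conclusion = the statement of `stub_coreDensity` verbatim, same constant):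
`E[N(L,h)] ≤ E[S(L,h)]` by `stub_numCrossingLe` in expectation (`CoreDensity.integral_numCrossing_le`). -/
theorem coreDensity_of_core
    (hC : ∃ C : ℝ, ∀ H : ℕ, ∃ h : ℕ, H ≤ h ∧ ∀ L : ℕ, h ≤ L →
      (h : ℝ) ^ 2 * ∫ ω, ((minOpenCutIn
          (Set.Icc (![0, 0, 0] : Site 3) ![(L : ℤ), (L : ℤ), (h : ℤ)])
          (Set.Icc (![0, 0, 0] : Site 3) ![(L : ℤ), (L : ℤ), 0])
          (Set.Icc (![0, 0, (h : ℤ)] : Site 3) ![(L : ℤ), (L : ℤ), (h : ℤ)])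
          ω).toNat : ℝ) ∂(bondPercolation (zdGraph 3) (criticalProbI 3)) ≤ C * (L : ℝ) ^ 2) :
    ∃ C : ℝ, ∀ H : ℕ, ∃ h : ℕ, H ≤ h ∧ ∀ L : ℕ, h ≤ L →
      (h : ℝ) ^ 2 * ∫ ω, (({c : ((openGraph ω).induce
          (Set.Icc (![0, 0, 0] : Site 3) ![(L : ℤ), (L : ℤ), (h : ℤ)])).ConnectedComponent |
        (∃ x : ↥(Set.Icc (![0, 0, 0] : Site 3) ![(L : ℤ), (L : ℤ), (h : ℤ)]),
          (x : Site 3) ∈ Set.Icc (![0, 0, 0] : Site 3) ![(L : ℤ), (L : ℤ), 0] ∧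
          ((openGraph ω).induce (Set.Icc (![0, 0, 0] : Site 3) ![(L : ℤ), (L : ℤ), (h : ℤ)])).connectedComponentMk x = c) ∧
        ∃ y : ↥(Set.Icc (![0, 0, 0] : Site 3) ![(L : ℤ), (L : ℤ), (h : ℤ)]),
          (y : Site 3) ∈ Set.Icc (![0, 0, (h : ℤ)] : Site 3) ![(L : ℤ), (L : ℤ), (h : ℤ)] ∧
          ((openGraph ω).induce (Set.Icc (![0, 0, 0] : Site 3) ![(L : ℤ), (L : ℤ), (h : ℤ)])).connectedComponentMk y = c}.encard).toNat : ℝ)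
        ∂(bondPercolation (zdGraph 3) (criticalProbI 3)) ≤ C * (L : ℝ) ^ 2 := by
  obtain ⟨C, hcore⟩ := hC
  refine ⟨C, fun H => ?_⟩
  obtain ⟨h, hHh, hL⟩ := hcore (max H 1)
  have hh1 : 1 ≤ h := le_trans (le_max_right _ _) hHh
  refine ⟨h, le_trans (le_max_left _ _) hHh, fun L hLh => ?_⟩
  refine le_trans ?_ (hL L hLh)
  refine mul_le_mul_of_nonneg_left ?_ (by positivity)
  exact _root_.Summit.CriticalPhenomena.PercolationContinuityZ3.Theorems.BudgetTightness.CoreDensity.integral_numCrossing_le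
    (Set.finite_Icc _ _) _ _ _
    (_root_.Summit.CriticalPhenomena.PercolationContinuityZ3.Theorems.BudgetTightness.StubSixLids.integrable_toNat_minOpenCutIn
      (Set.finite_Icc _ _) _ _ _ _)
    (slabBudget_ne_top hh1)

/-! ## Composition (kernel-checked, no `sorry` of its own) -/

/-- Arithmetic of the six-lids exchange rate: from `h² I ≤ C (4h+4)²` and `h ≥ 1`, `I ≤ 64 · max C 0`. -/
theorem integral_le_of_sq_mul_le {h : ℕ} (hh : 1 ≤ h) {I C : ℝ}
    (hle : (h : ℝ) ^ 2 * I ≤ C * (((4 * h + 4 : ℕ) : ℝ)) ^ 2) : I ≤ 64 * max C 0 := by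
  have hh1 : (1 : ℝ) ≤ h := by exact_mod_cast hh
  have hpos : (0 : ℝ) < (h : ℝ) ^ 2 := by positivity
  have h84 : (((4 * h + 4 : ℕ) : ℝ)) ≤ 8 * h := by push_cast; linarith
  have hsq : (((4 * h + 4 : ℕ) : ℝ)) ^ 2 ≤ 64 * (h : ℝ) ^ 2 := by nlinarith
  have hC : C * (((4 * h + 4 : ℕ) : ℝ)) ^ 2 ≤ max C 0 * (64 * (h : ℝ) ^ 2) :=
    calc C * (((4 * h + 4 : ℕ) : ℝ)) ^ 2 ≤ max C 0 * (((4 * h + 4 : ℕ) : ℝ)) ^ 2 :=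
          mul_le_mul_of_nonneg_right (le_max_left _ _) (by positivity)
      _ ≤ max C 0 * (64 * (h : ℝ) ^ 2) := mul_le_mul_of_nonneg_left hsq (le_max_right _ _)
  have : (h : ℝ) ^ 2 * I ≤ (h : ℝ) ^ 2 * (64 * max C 0) := by nlinarith
  exact le_of_mul_le_mul_left this hpos

/-- **Composition lemma (sorry-free; hypotheses = the statements of `stub_markov`, `stub_sixLids`,
`stub_core` verbatim).** Core ⇒ `E_{p_c}[S(4h+4, h)] ≤ 64 C⁺` along the good `h ≥ 1` ⇒ (six lids)
`E_{p_c}[MinCut(h+1, 2(h+1))] ≤ 384 C⁺` ⇒ `MeanCutBoundedIO(p_c)` with `l = 2` ⇒ (Markov) the crux. -/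
theorem line_composition
    (hM : (∃ (l : ℕ) (C : ℝ), 2 ≤ l ∧ ∀ N : ℕ, ∃ n : ℕ, N ≤ n ∧
      ∫ ω, ((minOpenCutIn (↑(box 3 (l * n)) : Set (Site 3)) (↑(box 3 n) : Set (Site 3))
        (↑(innerBoundary (zdGraph 3) (box 3 (l * n))) : Set (Site 3)) ω).toNat : ℝ)
        ∂(bondPercolation (zdGraph 3) (criticalProbI 3)) ≤ C) →
      ∃ (k l : ℕ) (c : ℝ), 2 ≤ l ∧ 0 < c ∧ ∀ N : ℕ, ∃ n : ℕ, N ≤ n ∧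
        c ≤ (bondPercolation (zdGraph 3) (criticalProbI 3)).real
          {ω | ∃ S : Finset (Sym2 (Site 3)), S.card ≤ k ∧
            ¬ ∃ x ∈ box 3 n, ∃ y ∈ innerBoundary (zdGraph 3) (box 3 (l * n)),
              (ω \ ↑S) ∈ openConnIn (↑(box 3 (l * n)) : Set (Site 3)) x y})
    (hS : ∀ (p : unitInterval) (h : ℕ), 1 ≤ h →
      ∫ ω, ((minOpenCutIn (↑(box 3 (2 * (h + 1))) : Set (Site 3)) (↑(box 3 (h + 1)) : Set (Site 3))
          (↑(innerBoundary (zdGraph 3) (box 3 (2 * (h + 1)))) : Set (Site 3)) ω).toNat : ℝ)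
          ∂(bondPercolation (zdGraph 3) p) ≤
      6 * ∫ ω, ((minOpenCutIn
          (Set.Icc (![0, 0, 0] : Site 3) ![((4 * h + 4 : ℕ) : ℤ), ((4 * h + 4 : ℕ) : ℤ), (h : ℤ)])
          (Set.Icc (![0, 0, 0] : Site 3) ![((4 * h + 4 : ℕ) : ℤ), ((4 * h + 4 : ℕ) : ℤ), 0])
          (Set.Icc (![0, 0, (h : ℤ)] : Site 3) ![((4 * h + 4 : ℕ) : ℤ), ((4 * h + 4 : ℕ) : ℤ), (h : ℤ)])
          ω).toNat : ℝ) ∂(bondPercolation (zdGraph 3) p))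
    (hC : ∃ C : ℝ, ∀ H : ℕ, ∃ h : ℕ, H ≤ h ∧ ∀ L : ℕ, h ≤ L →
      (h : ℝ) ^ 2 * ∫ ω, ((minOpenCutIn
          (Set.Icc (![0, 0, 0] : Site 3) ![(L : ℤ), (L : ℤ), (h : ℤ)])
          (Set.Icc (![0, 0, 0] : Site 3) ![(L : ℤ), (L : ℤ), 0])
          (Set.Icc (![0, 0, (h : ℤ)] : Site 3) ![(L : ℤ), (L : ℤ), (h : ℤ)])
          ω).toNat : ℝ) ∂(bondPercolation (zdGraph 3) (criticalProbI 3)) ≤ C * (L : ℝ) ^ 2) :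
    ∃ (k l : ℕ) (c : ℝ), 2 ≤ l ∧ 0 < c ∧ ∀ N : ℕ, ∃ n : ℕ, N ≤ n ∧
        c ≤ (bondPercolation (zdGraph 3) (criticalProbI 3)).real
          {ω | ∃ S : Finset (Sym2 (Site 3)), S.card ≤ k ∧
            ¬ ∃ x ∈ box 3 n, ∃ y ∈ innerBoundary (zdGraph 3) (box 3 (l * n)),
              (ω \ ↑S) ∈ openConnIn (↑(box 3 (l * n)) : Set (Site 3)) x y} := by
  obtain ⟨C, hcore⟩ := hC
  refine hM ⟨2, 384 * max C 0, le_rfl, fun N => ?_⟩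
  obtain ⟨h, hHh, hL⟩ := hcore (max N 1)
  have hh1 : 1 ≤ h := le_trans (le_max_right _ _) hHh
  have hslab := hL (4 * h + 4) (by omega)
  have hI : ∫ ω, ((minOpenCutIn
          (Set.Icc (![0, 0, 0] : Site 3) ![((4 * h + 4 : ℕ) : ℤ), ((4 * h + 4 : ℕ) : ℤ), (h : ℤ)])
          (Set.Icc (![0, 0, 0] : Site 3) ![((4 * h + 4 : ℕ) : ℤ), ((4 * h + 4 : ℕ) : ℤ), 0])
          (Set.Icc (![0, 0, (h : ℤ)] : Site 3) ![((4 * h + 4 : ℕ) : ℤ), ((4 * h + 4 : ℕ) : ℤ), (h : ℤ)])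
          ω).toNat : ℝ) ∂(bondPercolation (zdGraph 3) (criticalProbI 3)) ≤ 64 * max C 0 :=
    integral_le_of_sq_mul_le hh1 hslab
  refine ⟨h + 1, by omega, ?_⟩
  have hsix := hS (criticalProbI 3) h hh1
  calc ∫ ω, ((minOpenCutIn (↑(box 3 (2 * (h + 1))) : Set (Site 3)) (↑(box 3 (h + 1)) : Set (Site 3))
          (↑(innerBoundary (zdGraph 3) (box 3 (2 * (h + 1)))) : Set (Site 3)) ω).toNat : ℝ)
          ∂(bondPercolation (zdGraph 3) (criticalProbI 3))
      ≤ 6 * (64 * max C 0) := hsix.trans (by gcongr)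
    _ = 384 * max C 0 := by ring

/-- **The line concludes the crux BY NAME.** `BudgetTightness` (the route decl) from the three
registered stubs on the critical path; no `sorry` of its own — its only non-standard axiom is the
`sorryAx` of the stubs it invokes, which disappears as they are proved. -/
theorem BudgetTightness_of :
    Summit.CriticalPhenomena.PercolationContinuityZ3.Theses.PercBudgetLadder.BudgetTightness :=
  line_composition stub_markov stub_sixLids stub_core

/-! ## The converse: the dictionary is exact (kernel-checked modulo `stub_bkTail`, `stub_patchCutset`) -/

/-- Arithmetic of the patch exchange rate: for `n ≥ 1`, `l ≥ 2`, `L ≥ 2ln`,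
`(2ln)² · ⌈(L+1)/(2n+1)⌉² ≤ 4 l² L²`. -/
theorem patch_rate_le {n l L : ℕ} (hn : 1 ≤ n) (hl : 2 ≤ l) (hL : 2 * l * n ≤ L) :
    (((2 * l * n : ℕ) : ℝ)) ^ 2 * ((((L + 2 * n + 1) / (2 * n + 1) : ℕ) : ℝ)) ^ 2 ≤
      4 * (l : ℝ) ^ 2 * (L : ℝ) ^ 2 := by
  have hn1 : (1 : ℝ) ≤ n := by exact_mod_cast hn
  have hl2 : (2 : ℝ) ≤ l := by exact_mod_cast hl
  have hLr : 2 * (l : ℝ) * n ≤ L := by exact_mod_cast hL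
  have hd : (0 : ℝ) < 2 * n + 1 := by positivity
  -- `⌈(L+1)/(2n+1)⌉ ≤ (L + 2n + 1)/(2n+1) ≤ 2L/(2n+1) ≤ L/n`
  have hA : ((((L + 2 * n + 1) / (2 * n + 1) : ℕ) : ℝ)) ≤ (L : ℝ) / n := by
    have h1 : ((((L + 2 * n + 1) / (2 * n + 1) : ℕ) : ℝ)) ≤ ((L + 2 * n + 1 : ℕ) : ℝ) / ((2 * n + 1 : ℕ) : ℝ) :=
      Nat.cast_div_le
    have hL4 : 4 * (n : ℝ) ≤ L := by nlinarith
    have h2 : ((L + 2 * n + 1 : ℕ) : ℝ) / ((2 * n + 1 : ℕ) : ℝ) ≤ (L : ℝ) / n := by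
      rw [div_le_div_iff₀ (by positivity) (by positivity)]
      push_cast
      nlinarith [mul_le_mul_of_nonneg_right hL4 (by positivity : (0 : ℝ) ≤ n)]
    exact h1.trans h2
  have hA0 : (0 : ℝ) ≤ ((((L + 2 * n + 1) / (2 * n + 1) : ℕ) : ℝ)) := by positivity
  have hsq : ((((L + 2 * n + 1) / (2 * n + 1) : ℕ) : ℝ)) ^ 2 ≤ ((L : ℝ) / n) ^ 2 := by gcongr
  calc (((2 * l * n : ℕ) : ℝ)) ^ 2 * ((((L + 2 * n + 1) / (2 * n + 1) : ℕ) : ℝ)) ^ 2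
      ≤ (((2 * l * n : ℕ) : ℝ)) ^ 2 * ((L : ℝ) / n) ^ 2 := by gcongr
    _ = 4 * (l : ℝ) ^ 2 * (L : ℝ) ^ 2 := by
        push_cast
        field_simp
        ring

/-- **Dictionary lemma (sorry-free; hypotheses = the statements of `stub_bkTail` and
`stub_patchCutset` verbatim): the crux implies `SlabCutQuadraticIO(p_c)` (the statement of
`stub_core`).** From `BudgetTightness` get `(k, l, c)`; along the good `n ≥ 1` the budget event is
`{MinCut(n, l n) ≤ k}` (`minOpenCutIn_le_iff`), so `E[MinCut(n, l n)] ≤ (k+1)/c` (BK tail) and, with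
`h = 2 l n`, `h² E[S(L, h)] ≤ (2ln)² ⌈(L+1)/(2n+1)⌉² (k+1)/c ≤ 4 l² (k+1)/c · L²` for every `L ≥ h`
(patch cutsets). Together with `line_composition`: `stub_core ⟺ BudgetTightness` modulo the four
dictionary stubs. -/
theorem line_dictionary
    (hB : ∀ (p : unitInterval) (n l k : ℕ) (c : ℝ), 1 ≤ n → 2 ≤ l → 0 < c →
      c ≤ (bondPercolation (zdGraph 3) p).real
        {ω | minOpenCutIn (↑(box 3 (l * n)) : Set (Site 3)) (↑(box 3 n) : Set (Site 3))
          (↑(innerBoundary (zdGraph 3) (box 3 (l * n))) : Set (Site 3)) ω ≤ k} →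
      ∫ ω, ((minOpenCutIn (↑(box 3 (l * n)) : Set (Site 3)) (↑(box 3 n) : Set (Site 3))
          (↑(innerBoundary (zdGraph 3) (box 3 (l * n))) : Set (Site 3)) ω).toNat : ℝ)
          ∂(bondPercolation (zdGraph 3) p) ≤ ((k : ℝ) + 1) / c)
    (hP : ∀ (p : unitInterval) (m l L : ℕ), 1 ≤ m → 2 ≤ l →
      ∫ ω, ((minOpenCutIn
          (Set.Icc (![0, 0, 0] : Site 3) ![(L : ℤ), (L : ℤ), ((2 * l * m : ℕ) : ℤ)])
          (Set.Icc (![0, 0, 0] : Site 3) ![(L : ℤ), (L : ℤ), 0])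
          (Set.Icc (![0, 0, ((2 * l * m : ℕ) : ℤ)] : Site 3) ![(L : ℤ), (L : ℤ), ((2 * l * m : ℕ) : ℤ)])
          ω).toNat : ℝ) ∂(bondPercolation (zdGraph 3) p) ≤
      ((((L + 2 * m + 1) / (2 * m + 1) : ℕ) : ℝ)) ^ 2 *
        ∫ ω, ((minOpenCutIn (↑(box 3 (l * m)) : Set (Site 3)) (↑(box 3 m) : Set (Site 3))
          (↑(innerBoundary (zdGraph 3) (box 3 (l * m))) : Set (Site 3)) ω).toNat : ℝ)
          ∂(bondPercolation (zdGraph 3) p))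
    (hBT : Summit.CriticalPhenomena.PercolationContinuityZ3.Theses.PercBudgetLadder.BudgetTightness) :
    ∃ C : ℝ, ∀ H : ℕ, ∃ h : ℕ, H ≤ h ∧ ∀ L : ℕ, h ≤ L →
      (h : ℝ) ^ 2 * ∫ ω, ((minOpenCutIn
          (Set.Icc (![0, 0, 0] : Site 3) ![(L : ℤ), (L : ℤ), (h : ℤ)])
          (Set.Icc (![0, 0, 0] : Site 3) ![(L : ℤ), (L : ℤ), 0])
          (Set.Icc (![0, 0, (h : ℤ)] : Site 3) ![(L : ℤ), (L : ℤ), (h : ℤ)])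
          ω).toNat : ℝ) ∂(bondPercolation (zdGraph 3) (criticalProbI 3)) ≤ C * (L : ℝ) ^ 2 := by
  obtain ⟨k, l, c, hl, hc, hio⟩ := hBT
  refine ⟨4 * (l : ℝ) ^ 2 * (((k : ℝ) + 1) / c), fun H => ?_⟩
  obtain ⟨n, hn, hbound⟩ := hio (max H 1)
  have hn1 : 1 ≤ n := le_trans (le_max_right _ _) hn
  -- the route's event is `{MinCut(n, l n) ≤ k}`
  have hev : {ω : BondConfig (Site 3) | ∃ S : Finset (Sym2 (Site 3)), S.card ≤ k ∧
      ¬ ∃ x ∈ box 3 n, ∃ y ∈ innerBoundary (zdGraph 3) (box 3 (l * n)),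
        (ω \ ↑S) ∈ openConnIn (↑(box 3 (l * n)) : Set (Site 3)) x y} =
      {ω | minOpenCutIn (↑(box 3 (l * n)) : Set (Site 3)) (↑(box 3 n) : Set (Site 3))
          (↑(innerBoundary (zdGraph 3) (box 3 (l * n))) : Set (Site 3)) ω ≤ k} := by
    ext ω
    simp only [Set.mem_setOf_eq, minOpenCutIn_le_iff, Finset.mem_coe]
  rw [hev] at hbound
  have hmean := hB (criticalProbI 3) n l k c hn1 hl hc hbound
  have hHn : H ≤ 2 * l * n :=
    (le_trans (le_max_left _ _) hn).trans (Nat.le_mul_of_pos_left n (by omega))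
  refine ⟨2 * l * n, hHn, fun L hL => ?_⟩
  have hpatch := hP (criticalProbI 3) n l L hn1 hl
  have hI0 : 0 ≤ ∫ ω, ((minOpenCutIn (↑(box 3 (l * n)) : Set (Site 3)) (↑(box 3 n) : Set (Site 3))
          (↑(innerBoundary (zdGraph 3) (box 3 (l * n))) : Set (Site 3)) ω).toNat : ℝ)
          ∂(bondPercolation (zdGraph 3) (criticalProbI 3)) :=
    integral_nonneg fun ω => by positivity
  have hrate := patch_rate_le hn1 hl hL
  calc (((2 * l * n : ℕ) : ℝ)) ^ 2 * ∫ ω, ((minOpenCutIn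
          (Set.Icc (![0, 0, 0] : Site 3) ![(L : ℤ), (L : ℤ), ((2 * l * n : ℕ) : ℤ)])
          (Set.Icc (![0, 0, 0] : Site 3) ![(L : ℤ), (L : ℤ), 0])
          (Set.Icc (![0, 0, ((2 * l * n : ℕ) : ℤ)] : Site 3) ![(L : ℤ), (L : ℤ), ((2 * l * n : ℕ) : ℤ)])
          ω).toNat : ℝ) ∂(bondPercolation (zdGraph 3) (criticalProbI 3))
      ≤ (((2 * l * n : ℕ) : ℝ)) ^ 2 * (((((L + 2 * n + 1) / (2 * n + 1) : ℕ) : ℝ)) ^ 2 *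
          ∫ ω, ((minOpenCutIn (↑(box 3 (l * n)) : Set (Site 3)) (↑(box 3 n) : Set (Site 3))
            (↑(innerBoundary (zdGraph 3) (box 3 (l * n))) : Set (Site 3)) ω).toNat : ℝ)
            ∂(bondPercolation (zdGraph 3) (criticalProbI 3))) := by gcongr
    _ ≤ (((2 * l * n : ℕ) : ℝ)) ^ 2 * ((((L + 2 * n + 1) / (2 * n + 1) : ℕ) : ℝ)) ^ 2 *
          (((k : ℝ) + 1) / c) := by rw [← mul_assoc]; gcongr
    _ ≤ 4 * (l : ℝ) ^ 2 * (L : ℝ) ^ 2 * (((k : ℝ) + 1) / c) :=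
        mul_le_mul_of_nonneg_right hrate (div_nonneg (by positivity) hc.le)
    _ = 4 * (l : ℝ) ^ 2 * (((k : ℝ) + 1) / c) * (L : ℝ) ^ 2 := by ring

/-- **The exact dictionary, by name**: modulo the registered stubs `stub_bkTail` and
`stub_patchCutset`, the crux implies the open core `stub_core`'s statement; with
`line_composition` the two are EQUIVALENT (nothing is given away by the line). -/
theorem slabCutQuadraticIO_of_budgetTightness
    (hBT : Summit.CriticalPhenomena.PercolationContinuityZ3.Theses.PercBudgetLadder.BudgetTightness) :
    ∃ C : ℝ, ∀ H : ℕ, ∃ h : ℕ, H ≤ h ∧ ∀ L : ℕ, h ≤ L →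
      (h : ℝ) ^ 2 * ∫ ω, ((minOpenCutIn
          (Set.Icc (![0, 0, 0] : Site 3) ![(L : ℤ), (L : ℤ), (h : ℤ)])
          (Set.Icc (![0, 0, 0] : Site 3) ![(L : ℤ), (L : ℤ), 0])
          (Set.Icc (![0, 0, (h : ℤ)] : Site 3) ![(L : ℤ), (L : ℤ), (h : ℤ)])
          ω).toNat : ℝ) ∂(bondPercolation (zdGraph 3) (criticalProbI 3)) ≤ C * (L : ℝ) ^ 2 :=
  line_dictionary stub_bkTail stub_patchCutset hBT

/-- **stub_dictionary (registered so that the dictionary file can land `--supports` the crux; PROVED here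
from the four dictionary stubs, landed as `Theorems/PercBudgetLadderBudgetTightnessDictionary.lean`):
`BudgetTightness ⟺ SlabCutQuadraticIO(p_c)`.** -/
theorem stub_dictionary :
    Summit.CriticalPhenomena.PercolationContinuityZ3.Theses.PercBudgetLadder.BudgetTightness ↔
      ∃ C : ℝ, ∀ H : ℕ, ∃ h : ℕ, H ≤ h ∧ ∀ L : ℕ, h ≤ L →
        (h : ℝ) ^ 2 * ∫ ω, ((minOpenCutIn
            (Set.Icc (![0, 0, 0] : Site 3) ![(L : ℤ), (L : ℤ), (h : ℤ)])
            (Set.Icc (![0, 0, 0] : Site 3) ![(L : ℤ), (L : ℤ), 0])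
            (Set.Icc (![0, 0, (h : ℤ)] : Site 3) ![(L : ℤ), (L : ℤ), (h : ℤ)])
            ω).toNat : ℝ) ∂(bondPercolation (zdGraph 3) (criticalProbI 3)) ≤ C * (L : ℝ) ^ 2 :=
  ⟨slabCutQuadraticIO_of_budgetTightness, line_composition stub_markov stub_sixLids⟩

end Summit.CriticalPhenomena.PercolationContinuityZ3.Cruxes.BudgetTightness.LineSketch

end
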